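import Summits.AtomisticToContinuum.HydrodynamicLimit.Theorems.MourreKoopmanChargesOneBodyCompletenessIdentificationTorus
import HarnessLib

/-!
# `OneBodyCompleteness` (crux stmt-AtomisticToContinuum-9583, route `MourreKoopmanCharges`), line `registered`:
# exact decomposition of the torus two-time moment of one-body fields into blown-up two-time cell pair functionals

Helper file (`--supports stmt-AtomisticToContinuum-9583`) for the registered OPEN CORE #2 `stub_torusIdentificationUnit`
of `Cruxes/OneBodyCompleteness/Lines/birth.lean` — the TORUS SIDE of its reduction to the two named inputs
`TwoTimeLocalLimitUnit` (I1) / `UniformTorusTwoTimeClustering` (I2) of `…IdentificationInputs.lean`, continued from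
`…IdentificationTorus.lean` (label forms `cellSum`, the two partitions of unity).

For `N + 1` particles on `𝕋³`, a hard-sphere flow `Φ` of diameter `ε = hsDiameter σ N`, the canonical law
`G = localGibbsLaw σ 1 0 θ N Φ` (`0 < σ ≤ 1/2`, `θ > 0`), continuous `χ`, continuous polynomially bounded `h` and a
time `t` (`z' = Φ_t z`):

* `integrable_cellSum_pair` — the two-time cell pair integrand `((x, ξ), z) ↦ cellSum ε χ h x ξ z' · cellSum ε χ h x 0 z`
  is integrable on `(𝕋³ × ℝ³) × G` (domination by `‖χ‖²_∞ (Σ_j |h(v_j)|) Σ_i |h(v'_i)| 1_C(bpos ε x x'_i - ξ)`, whose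
  `(x, ξ)`-sections have unit mass and whose `z`-weights are products of two `L²(G)` functions, `h(v_j)` being
  `N(0, θ)`-distributed and the flow preserving `G`);
* `integral_cellSum_pair_section` — at fixed configurations the `(x, ξ)`-integral is `ε³ (Σ_i c'_i)(Σ_j c_j)`,
  `c_j = χ(x_j) h(v_j)` (the two partitions of unity);
* `decomposition_twoTimeMoment` — Fubini and `(N+1) ε³ = σ³` give, once `3ε < 1/2`, the EXACT DECOMPOSITION
  `(N+1) · E_G[A(z') A(z)] = σ⁻³ ∫_{𝕋³ × ℝ³} E_G[cellSum ε χ h x ξ z' · cellSum ε χ h x 0 z] d(x, ξ)`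
  of the two-time moment of the one-body empirical field `A(z) = ∫ χ(y.1) h(y.2) d(empiricalMeasure z)`;
* `memLp_two_cellSum`, `integrable_cellSum_flow_mul` — `L²(G)` bounds of the weighted label forms (used to split
  integrals in the reduction).

References: S. Olla, S. R. S. Varadhan, H.-T. Yau, Comm. Math. Phys. 155 (1993) §4 (4.1); H. Spohn, *Large Scale
Dynamics of Interacting Particles* (1991), Part I §7.1 (7.14).
-/

noncomputable section

namespace Summit.AtomisticToContinuum.HydrodynamicLimit.Theorems.MourreKoopmanChargesOneBodyCompleteness

open MeasureTheory ProbabilityTheory Filter Topology Set Function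
open scoped ENNReal InnerProductSpace BigOperators
open Literature.Analysis.FluidPDE Literature.MathematicalPhysics.KineticTheory
open Literature.Analysis.FunctionSpaces (PointConfig)
open Literature.Analysis.FunctionSpaces.Torus (proj continuous_proj)
open Literature.Analysis.FluidPDE.Torus (reprSym measurable_reprSym proj_reprSym)
open Summit.AtomisticToContinuum.HydrodynamicLimit.Theorems.MourreKoopmanChargesIdealGasNoDecay
  (exists_bound_of_continuous)

/-! ### `L²(G)` weights and the blown-up cell indicator on `(𝕋³ × ℝ³) × G` -/

section Decomposition

variable {σ θ : ℝ} {N : ℕ}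

/-- `Σ_j |h(v_j)|` is square integrable under the canonical law (each `v_j` is `N(0, θ)`-distributed). [folklore] -/
theorem memLp_two_sum_abs (hθ : 0 < θ) (hσ : σ ≤ 1 / 2)
    (Φ : HardSphereFlow (Torus.geometry (Fin 3)) (hsDiameter σ N) (N + 1)) {h : V3 → ℝ} (hh : Continuous h)
    {C : ℝ} {k : ℕ} (hCk : ∀ v, |h v| ≤ C * (1 + ‖v‖) ^ k) :
    MemLp (fun z : Config (N + 1) (Fin 3) T3 => ∑ j, |h (z j).2|) 2
      (localGibbsLaw σ (fun _ => 1) (fun _ => 0) (fun _ => θ) N Φ) := by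
  have h2 : MemLp (fun v => |h v|) 2 (gaussMeasure (0 : V3) θ) := (memLp_two_gaussMeasure_of_poly_growth θ hh hCk).abs
  have := memLp_finsetSum (f := fun (j : Fin (N + 1)) (z : Config (N + 1) (Fin 3) T3) => (1 : ℝ) * |h (z j).2|)
    Finset.univ fun j _ => memLp_two_summand_localGibbsLaw_one hθ hσ N Φ (χ := fun _ => (1 : ℝ))
      measurable_const (Cχ := 1) (fun _ => by simp) h2 j
  simpa only [one_mul] using this

/-- **A `z`-weight times a blown-up cell indicator is integrable on `(𝕋³ × ℝ³) × G`**: for an integrable weight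
`k` on configurations and a measurable label position `q(z)`, `((x, ξ), z) ↦ k(z) 1_C(ε⁻¹ • reprSym (q - x)(z) - ξ)` is integrable
(its `(x, ξ)`-sections have mass `|k(z)|`). [folklore] -/
theorem integrable_weight_mul_indicator (G : Measure (Config (N + 1) (Fin 3) T3)) [SFinite G] (ε : ℝ)
    {k : Config (N + 1) (Fin 3) T3 → ℝ} (hkm : Measurable k) (hk : Integrable k G)
    {q : Config (N + 1) (Fin 3) T3 → T3} (hq : Measurable q) :
    Integrable (fun r : (T3 × V3) × Config (N + 1) (Fin 3) T3 =>
        k r.2 * (unitCell : Set V3).indicator (fun _ => (1 : ℝ)) (ε⁻¹ • reprSym (q r.2 - r.1.1) - r.1.2))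
      (((volume : Measure T3).prod (volume : Measure V3)).prod G) := by
  have hmeas : Measurable fun r : (T3 × V3) × Config (N + 1) (Fin 3) T3 =>
      k r.2 * (unitCell : Set V3).indicator (fun _ => (1 : ℝ)) (ε⁻¹ • reprSym (q r.2 - r.1.1) - r.1.2) :=
    (hkm.comp measurable_snd).mul ((measurable_const.indicator measurableSet_unitCell).comp
      (((measurable_bpos ε).comp ((measurable_fst.comp measurable_fst).prodMk (hq.comp measurable_snd))).sub
        (measurable_snd.comp measurable_fst)))
  refine (integrable_prod_iff' hmeas.aestronglyMeasurable).2 ⟨ae_of_all _ fun z => ?_, ?_⟩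
  · have h1 := (integrable_indicator_bpos_sub_prod ε (q z)).1.const_mul (k z)
    exact h1
  · have e : (fun z => ∫ p : T3 × V3, ‖k z * (unitCell : Set V3).indicator (fun _ => (1 : ℝ)) (ε⁻¹ • reprSym (q z - p.1) - p.2)‖
        ∂((volume : Measure T3).prod (volume : Measure V3))) = fun z => ‖k z‖ := by
      funext z
      have e1 : (fun p : T3 × V3 => ‖k z * (unitCell : Set V3).indicator (fun _ => (1 : ℝ)) (ε⁻¹ • reprSym (q z - p.1) - p.2)‖) =
          fun p : T3 × V3 => ‖k z‖ * (unitCell : Set V3).indicator (fun _ => (1 : ℝ)) (ε⁻¹ • reprSym (q z - p.1) - p.2) := by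
        funext p
        rw [norm_mul, norm_indicator_eq_indicator_norm, norm_one]
      rw [e1, integral_const_mul, (integrable_indicator_bpos_sub_prod ε (q z)).2, mul_one]
    rw [e]
    exact hk.norm

variable (cs : ∀ {n : ℕ}, ℝ → (T3 → ℝ) → (V3 → ℝ) → T3 → V3 → Config n (Fin 3) T3 → ℝ)
  (hcs : ∀ {n : ℕ} (ε : ℝ) (χ : T3 → ℝ) (h : V3 → ℝ) (x : T3) (ξ : V3) (z : Config n (Fin 3) T3),
    cs ε χ h x ξ z = ∑ j, (unitCell : Set V3).indicator (fun _ => (1 : ℝ)) (ε⁻¹ • reprSym ((z j).1 - x) - ξ) *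
      (χ (z j).1 * h (z j).2))
include hcs

/-! ### Integrability of the two-time cell pair integrand and the exact decomposition -/

/-- **Integrability of the two-time cell pair integrand** `((x, ξ), z) ↦ cs ε χ h x ξ (Φ_t z) · cs ε χ h x 0 z`
on `(𝕋³ × ℝ³) × G_N` (domination by `‖χ‖²_∞ (Σ_j |h(v_j)|) Σ_i |h(v'_i)| 1_C(ε⁻¹ • reprSym (x'_i - x) - ξ)`, whose `(x, ξ)`-sections
have unit mass and whose `z`-weights are products of two `L²(G_N)` functions). [folklore] -/
theorem integrable_cellSum_pair (hθ : 0 < θ) (hσ : σ ≤ 1 / 2)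
    (Φ : HardSphereFlow (Torus.geometry (Fin 3)) (hsDiameter σ N) (N + 1)) {χ : T3 → ℝ} (hχ : Continuous χ)
    {h : V3 → ℝ} (hh : Continuous h) (hb : ∃ (C : ℝ) (k : ℕ), ∀ v, |h v| ≤ C * (1 + ‖v‖) ^ k) (ε t : ℝ) :
    Integrable (fun q : (T3 × V3) × Config (N + 1) (Fin 3) T3 =>
        cs ε χ h q.1.1 q.1.2 (Φ.flow t q.2) * cs ε χ h q.1.1 0 q.2)
      (((volume : Measure T3).prod (volume : Measure V3)).prod
        (localGibbsLaw σ (fun _ => 1) (fun _ => 0) (fun _ => θ) N Φ)) := by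
  obtain ⟨C, k, hCk⟩ := hb
  obtain ⟨B, hB0, hB⟩ := exists_bound_of_continuous hχ
  haveI : IsProbabilityMeasure (localGibbsLaw σ (fun _ => 1) (fun _ => 0) (fun _ => θ) N Φ) :=
    isProbabilityMeasure_localGibbsLaw_const hθ hσ (0 : V3) N Φ
  have hflow : Measurable (Φ.flow t) := Φ.measurable_flow t
  -- the `z`-weights `k_i(z) = B² (Σ_j |h(v_j)|) |h(v'_i)|` are integrable
  have hSm : Measurable fun z : Config (N + 1) (Fin 3) T3 => ∑ j, |h (z j).2| := Finset.measurable_sum _ fun j _ =>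
    (continuous_abs.measurable.comp (hh.measurable.comp (measurable_pi_apply j).snd))
  have hS2 := memLp_two_sum_abs hθ hσ Φ hh hCk
  have hhi : ∀ i : Fin (N + 1), MemLp (fun z : Config (N + 1) (Fin 3) T3 => |h ((Φ.flow t z) i).2|) 2
      (localGibbsLaw σ (fun _ => 1) (fun _ => 0) (fun _ => θ) N Φ) := by
    intro i
    have h1 : MemLp (fun z : Config (N + 1) (Fin 3) T3 => |h (z i).2|) 2
        (localGibbsLaw σ (fun _ => 1) (fun _ => 0) (fun _ => θ) N Φ) :=
      ((memLp_two_gaussMeasure_of_poly_growth θ hh hCk).comp_measurePreserving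
        (measurePreserving_vel_localGibbsLaw_one hθ hσ N Φ i)).abs
    exact h1.comp_measurePreserving (measurePreserving_flow_localGibbsLaw_const σ 1 θ 0 N Φ t)
  have hkm : ∀ i : Fin (N + 1), Measurable fun z : Config (N + 1) (Fin 3) T3 =>
      B ^ 2 * ((∑ j, |h (z j).2|) * |h ((Φ.flow t z) i).2|) := fun i =>
    measurable_const.mul (hSm.mul (continuous_abs.measurable.comp
      (hh.measurable.comp ((measurable_pi_apply i).comp hflow).snd)))
  have hki : ∀ i : Fin (N + 1), Integrable (fun z : Config (N + 1) (Fin 3) T3 =>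
      B ^ 2 * ((∑ j, |h (z j).2|) * |h ((Φ.flow t z) i).2|))
      (localGibbsLaw σ (fun _ => 1) (fun _ => 0) (fun _ => θ) N Φ) := fun i =>
    (hS2.integrable_mul (hhi i)).const_mul _
  -- the majorant
  have hM : Integrable (fun r : (T3 × V3) × Config (N + 1) (Fin 3) T3 =>
      ∑ i, B ^ 2 * ((∑ j, |h (r.2 j).2|) * |h ((Φ.flow t r.2) i).2|) *
        (unitCell : Set V3).indicator (fun _ => (1 : ℝ)) (ε⁻¹ • reprSym (((Φ.flow t r.2) i).1 - r.1.1) - r.1.2))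
      (((volume : Measure T3).prod (volume : Measure V3)).prod
        (localGibbsLaw σ (fun _ => 1) (fun _ => 0) (fun _ => θ) N Φ)) := by
    refine integrable_finsetSum _ fun i _ => ?_
    have h1 := integrable_weight_mul_indicator (localGibbsLaw σ (fun _ => 1) (fun _ => 0) (fun _ => θ) N Φ) ε
      (hkm i) (hki i) ((measurable_pi_apply i).comp hflow).fst
    exact h1
  -- domination
  have hΨm : Measurable fun q : (T3 × V3) × Config (N + 1) (Fin 3) T3 =>
      cs ε χ h q.1.1 q.1.2 (Φ.flow t q.2) * cs ε χ h q.1.1 0 q.2 :=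
    (measurable_cellSum cs hcs ε hχ.measurable hh.measurable (measurable_fst.comp measurable_fst)
      (measurable_snd.comp measurable_fst) (hflow.comp measurable_snd)).mul
      (measurable_cellSum cs hcs ε hχ.measurable hh.measurable (measurable_fst.comp measurable_fst) measurable_const
        measurable_snd)
  refine hM.mono' hΨm.aestronglyMeasurable (ae_of_all _ fun q => ?_)
  rw [Real.norm_eq_abs, abs_mul]
  have h1 := abs_cellSum_le cs hcs ε hB h q.1.1 q.1.2 (Φ.flow t q.2)
  have h2 := abs_cellSum_le' cs hcs ε hB h q.1.1 0 q.2
  have hind0 : ∀ i, 0 ≤ (unitCell : Set V3).indicator (fun _ => (1 : ℝ)) (ε⁻¹ • reprSym (((Φ.flow t q.2) i).1 - q.1.1) - q.1.2) :=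
    fun i => by
    by_cases hm : ε⁻¹ • reprSym (((Φ.flow t q.2) i).1 - q.1.1) - q.1.2 ∈ (unitCell : Set V3)
    · simp [Set.indicator_of_mem hm]
    · simp [Set.indicator_of_notMem hm]
  calc |cs ε χ h q.1.1 q.1.2 (Φ.flow t q.2)| * |cs ε χ h q.1.1 0 q.2|
      ≤ (B * ∑ i, (unitCell : Set V3).indicator (fun _ => (1 : ℝ)) (ε⁻¹ • reprSym (((Φ.flow t q.2) i).1 - q.1.1) - q.1.2) *
          |h ((Φ.flow t q.2) i).2|) * (B * ∑ j, |h (q.2 j).2|) :=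
        mul_le_mul h1 h2 (abs_nonneg _) (mul_nonneg hB0 (Finset.sum_nonneg fun i _ =>
          mul_nonneg (hind0 i) (abs_nonneg _)))
    _ = ∑ i, B ^ 2 * ((∑ j, |h (q.2 j).2|) * |h ((Φ.flow t q.2) i).2|) *
          (unitCell : Set V3).indicator (fun _ => (1 : ℝ)) (ε⁻¹ • reprSym (((Φ.flow t q.2) i).1 - q.1.1) - q.1.2) := by
        rw [Finset.mul_sum, Finset.sum_mul]
        refine Finset.sum_congr rfl fun i _ => ?_
        ring

/-- **Fubini for the two-time cell pair integrand at fixed configurations**: for every `z, z'`,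
`∫_{𝕋³ × ℝ³} cs ε χ h x ξ z' · cs ε χ h x 0 z d(x, ξ) = ε³ (Σ_i χ(x'_i) h(v'_i)) (Σ_j χ(x_j) h(v_j))` once
`0 < ε`, `3ε < 1/2` (offset partition of unity in `ξ`, base-point partition of unity in `x`). [folklore] -/
theorem integral_cellSum_pair_section {ε : ℝ} (hε : 0 < ε) (hε3 : ε * 3 < 1 / 2) {χ : T3 → ℝ} (hχ : Continuous χ)
    {h : V3 → ℝ} (hh : Continuous h) (z z' : Config (N + 1) (Fin 3) T3) :
    ∫ p : T3 × V3, cs ε χ h p.1 p.2 z' * cs ε χ h p.1 0 z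
      ∂((volume : Measure T3).prod (volume : Measure V3)) =
      ε ^ 3 * ((∑ i, χ (z' i).1 * h (z' i).2) * ∑ j, χ (z j).1 * h (z j).2) := by
  obtain ⟨B, hB0, hB⟩ := exists_bound_of_continuous hχ
  -- integrability of the section (domination by the unit-mass cell indicators)
  have hm : Measurable fun p : T3 × V3 => cs ε χ h p.1 p.2 z' * cs ε χ h p.1 0 z :=
    (measurable_cellSum cs hcs ε hχ.measurable hh.measurable measurable_fst measurable_snd measurable_const).mul
      (measurable_cellSum cs hcs ε hχ.measurable hh.measurable measurable_fst measurable_const measurable_const)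
  have hint : Integrable (fun p : T3 × V3 => cs ε χ h p.1 p.2 z' * cs ε χ h p.1 0 z)
      ((volume : Measure T3).prod (volume : Measure V3)) := by
    have hM : Integrable (fun p : T3 × V3 => ∑ i, (B * |h (z' i).2| * (B * ∑ j, |h (z j).2|)) *
        (unitCell : Set V3).indicator (fun _ => (1 : ℝ)) (ε⁻¹ • reprSym ((z' i).1 - p.1) - p.2))
        ((volume : Measure T3).prod (volume : Measure V3)) := by
      refine integrable_finsetSum _ fun i _ => ?_
      have h1 := (integrable_indicator_bpos_sub_prod ε (z' i).1).1.const_mul (B * |h (z' i).2| * (B * ∑ j, |h (z j).2|))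
      exact h1
    refine hM.mono' hm.aestronglyMeasurable (ae_of_all _ fun p => ?_)
    rw [Real.norm_eq_abs, abs_mul]
    have h1 := abs_cellSum_le cs hcs ε hB h p.1 p.2 z'
    have h2 := abs_cellSum_le' cs hcs ε hB h p.1 0 z
    have hind0 : ∀ i, 0 ≤ (unitCell : Set V3).indicator (fun _ => (1 : ℝ)) (ε⁻¹ • reprSym ((z' i).1 - p.1) - p.2) := fun i => by
      by_cases hq : ε⁻¹ • reprSym ((z' i).1 - p.1) - p.2 ∈ (unitCell : Set V3)
      · simp [Set.indicator_of_mem hq]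
      · simp [Set.indicator_of_notMem hq]
    calc |cs ε χ h p.1 p.2 z'| * |cs ε χ h p.1 0 z|
        ≤ (B * ∑ i, (unitCell : Set V3).indicator (fun _ => (1 : ℝ)) (ε⁻¹ • reprSym ((z' i).1 - p.1) - p.2) * |h (z' i).2|) *
            (B * ∑ j, |h (z j).2|) :=
          mul_le_mul h1 h2 (abs_nonneg _) (mul_nonneg hB0 (Finset.sum_nonneg fun i _ =>
            mul_nonneg (hind0 i) (abs_nonneg _)))
      _ = ∑ i, (B * |h (z' i).2| * (B * ∑ j, |h (z j).2|)) *
            (unitCell : Set V3).indicator (fun _ => (1 : ℝ)) (ε⁻¹ • reprSym ((z' i).1 - p.1) - p.2) := by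
          rw [Finset.mul_sum, Finset.sum_mul]
          refine Finset.sum_congr rfl fun i _ => ?_
          ring
  rw [integral_prod _ hint]
  have e : (fun x : T3 => ∫ ξ : V3, cs ε χ h (x, ξ).1 (x, ξ).2 z' * cs ε χ h (x, ξ).1 0 z) =
      fun x : T3 => (∑ i, χ (z' i).1 * h (z' i).2) * cs ε χ h x 0 z := by
    funext x
    simp only
    rw [integral_mul_const, integral_cellSum_offset cs hcs]
  rw [e, integral_const_mul, integral_cellSum_zero cs hcs hε hε3]
  ring

/-- **EXACT DECOMPOSITION OF THE TORUS TWO-TIME MOMENT** (torus side of the reduction of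
`stub_torusIdentificationUnit`): for `0 < σ ≤ 1/2`, `θ > 0`, `N` with `3 ε_N < 1/2`, continuous `χ`, continuous
polynomially bounded `h`, every flow `Φ` and time `t`,
`(N+1) · E_{G_N}[A(Φ_t z) A(z)] = σ⁻³ ∫_{𝕋³ × ℝ³} E_{G_N}[cs ε χ h x ξ (Φ_t z) · cs ε χ h x 0 z] d(x, ξ)`,
`A(z) = ∫ χ(y.1) h(y.2) d(empiricalMeasure z)` — the two partitions of unity and Fubini, with `(N+1) ε³ = σ³`.
[OllaVaradhanYau1993 §4 (4.1); Spohn1991 Part I §7.1 (7.14)] -/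
theorem decomposition_twoTimeMoment (hσ0 : 0 < σ) (hσ : σ ≤ 1 / 2) (hθ : 0 < θ)
    (hN : hsDiameter σ N * 3 < 1 / 2)
    (Φ : HardSphereFlow (Torus.geometry (Fin 3)) (hsDiameter σ N) (N + 1)) {χ : T3 → ℝ} (hχ : Continuous χ)
    {h : V3 → ℝ} (hh : Continuous h) (hb : ∃ (C : ℝ) (k : ℕ), ∀ v, |h v| ≤ C * (1 + ‖v‖) ^ k) (t : ℝ) :
    ((N : ℝ) + 1) * ∫ z, (∫ y, χ y.1 * h y.2 ∂(empiricalMeasure (Φ.flow t z))) *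
        (∫ y, χ y.1 * h y.2 ∂(empiricalMeasure z)) ∂(localGibbsLaw σ (fun _ => 1) (fun _ => 0) (fun _ => θ) N Φ) =
      (σ ^ 3)⁻¹ * ∫ p : T3 × V3, ∫ z, cs (hsDiameter σ N) χ h p.1 p.2 (Φ.flow t z) *
          cs (hsDiameter σ N) χ h p.1 0 z ∂(localGibbsLaw σ (fun _ => 1) (fun _ => 0) (fun _ => θ) N Φ)
        ∂((volume : Measure T3).prod (volume : Measure V3)) := by
  haveI : IsProbabilityMeasure (localGibbsLaw σ (fun _ => 1) (fun _ => 0) (fun _ => θ) N Φ) :=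
    isProbabilityMeasure_localGibbsLaw_const hθ hσ (0 : V3) N Φ
  have hε : 0 < hsDiameter σ N := hsDiameter_pos hσ0 N
  -- Fubini
  have hF := integrable_cellSum_pair cs hcs hθ hσ Φ hχ hh hb (hsDiameter σ N) t
  rw [integral_integral_swap hF]
  -- the sections
  have e1 : (fun z => ∫ p : T3 × V3, cs (hsDiameter σ N) χ h p.1 p.2 (Φ.flow t z) *
      cs (hsDiameter σ N) χ h p.1 0 z ∂((volume : Measure T3).prod (volume : Measure V3))) =
      fun z => hsDiameter σ N ^ 3 * (((N + 1 : ℕ) : ℝ) * (∫ y, χ y.1 * h y.2 ∂(empiricalMeasure (Φ.flow t z))) *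
        (((N + 1 : ℕ) : ℝ) * ∫ y, χ y.1 * h y.2 ∂(empiricalMeasure z))) := by
    funext z
    rw [integral_cellSum_pair_section cs hcs hε hN hχ hh z (Φ.flow t z), oneBodyField_eq_sum χ h, oneBodyField_eq_sum χ h]
    have hNe : ((N + 1 : ℕ) : ℝ) ≠ 0 := by positivity
    congr 1
    field_simp
  rw [e1, integral_const_mul, ← mul_assoc]
  have hNe : ((N : ℝ) + 1) ≠ 0 := by positivity
  have hσ3 : σ ^ 3 ≠ 0 := by positivity
  have hε3 : ((N : ℝ) + 1) * hsDiameter σ N ^ 3 = σ ^ 3 := by exact_mod_cast succ_mul_hsDiameter_pow_three σ N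
  have e : (σ ^ 3)⁻¹ * hsDiameter σ N ^ 3 = ((N : ℝ) + 1)⁻¹ := by
    rw [← hε3]; field_simp
  rw [e, ← integral_const_mul, ← integral_const_mul]
  refine integral_congr_ae (ae_of_all _ fun z => ?_)
  push_cast
  field_simp

/-! ### `L²(G)` bounds for the label forms (used to split integrals in the reduction) -/

/-- **The weighted label form is square integrable under the canonical law** for a bounded measurable weight and a
continuous polynomially bounded profile (`|cellSum| ≤ B Σ_j |h(v_j)|`-type domination term by term). [folklore] -/
theorem memLp_two_cellSum (hθ : 0 < θ) (hσ : σ ≤ 1 / 2)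
    (Φ : HardSphereFlow (Torus.geometry (Fin 3)) (hsDiameter σ N) (N + 1)) (ε : ℝ) {W : T3 → ℝ} (hW : Measurable W)
    {B : ℝ} (hWB : ∀ y, |W y| ≤ B) {h : V3 → ℝ} (hh : Continuous h)
    (hb : ∃ (C : ℝ) (k : ℕ), ∀ v, |h v| ≤ C * (1 + ‖v‖) ^ k) (x : T3) (ξ : V3) :
    MemLp (fun z : Config (N + 1) (Fin 3) T3 => cs ε W h x ξ z) 2
      (localGibbsLaw σ (fun _ => 1) (fun _ => 0) (fun _ => θ) N Φ) := by
  obtain ⟨C, k, hCk⟩ := hb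
  simp only [hcs]
  refine memLp_finsetSum _ fun j _ => ?_
  have hg := memLp_two_summand_localGibbsLaw_one hθ hσ N Φ hW hWB (memLp_two_gaussMeasure_of_poly_growth θ hh hCk) j
  have hfm : Measurable fun z : Config (N + 1) (Fin 3) T3 =>
      (unitCell : Set V3).indicator (fun _ => (1 : ℝ)) (ε⁻¹ • reprSym ((z j).1 - x) - ξ) * (W (z j).1 * h (z j).2) :=
    ((measurable_const.indicator measurableSet_unitCell).comp
      (((measurable_bpos ε).comp (measurable_const.prodMk (measurable_pi_apply j).fst)).sub measurable_const)).mul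
      ((hW.comp (measurable_pi_apply j).fst).mul (hh.measurable.comp (measurable_pi_apply j).snd))
  refine hg.of_le hfm.aestronglyMeasurable (ae_of_all _ fun z => ?_)
  rw [norm_mul]
  refine mul_le_of_le_one_left (norm_nonneg _) ?_
  by_cases hm : ε⁻¹ • reprSym ((z j).1 - x) - ξ ∈ (unitCell : Set V3)
  · simp [Set.indicator_of_mem hm]
  · simp [Set.indicator_of_notMem hm]

/-- Two-time products of weighted label forms are integrable under the canonical law (two `L²` factors, the flow
preserves the law). [folklore] -/
theorem integrable_cellSum_flow_mul (hθ : 0 < θ) (hσ : σ ≤ 1 / 2)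
    (Φ : HardSphereFlow (Torus.geometry (Fin 3)) (hsDiameter σ N) (N + 1)) (ε t : ℝ) {W W' : T3 → ℝ}
    (hW : Measurable W) (hW' : Measurable W') {B B' : ℝ} (hWB : ∀ y, |W y| ≤ B) (hWB' : ∀ y, |W' y| ≤ B')
    {h : V3 → ℝ} (hh : Continuous h) (hb : ∃ (C : ℝ) (k : ℕ), ∀ v, |h v| ≤ C * (1 + ‖v‖) ^ k) (x : T3) (ξ ξ' : V3) :
    Integrable (fun z : Config (N + 1) (Fin 3) T3 => cs ε W h x ξ (Φ.flow t z) * cs ε W' h x ξ' z)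
      (localGibbsLaw σ (fun _ => 1) (fun _ => 0) (fun _ => θ) N Φ) :=
  ((memLp_two_cellSum cs hcs hθ hσ Φ ε hW hWB hh hb x ξ).comp_measurePreserving
    (measurePreserving_flow_localGibbsLaw_const σ 1 θ 0 N Φ t)).integrable_mul
    (memLp_two_cellSum cs hcs hθ hσ Φ ε hW' hWB' hh hb x ξ')

end Decomposition

end Summit.AtomisticToContinuum.HydrodynamicLimit.Theorems.MourreKoopmanChargesOneBodyCompleteness

end
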